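import Summits.Ventures.PercRepro.C026PFunCutVertexFree
import Summits.Ventures.PercRepro.C026GoodDegreeForms

/-!
# ROW C-041 `(G⅔)` is invariant under a mark-free side at a cut vertex (p6, gen 23)

Setting of p5's cut-vertex dictionary (`C026CutVertex`): `v` is a cut vertex of the two-colouring
`side : E → Bool` (`IsGluing v v v side`), the two sides are `G.part side true` and `G.part side false`,
and a configuration of `G` is the pair of its restrictions.  When the probe `c` and both terminals `a, b`
lie on side `true` (or are `v`) — the other side is MARK-FREE (a pendant tree, a block hanging at a cut
vertex, …) — every count of ROW C-041 on `G` is the corresponding count on `G₁ = G.part side true` times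
the number `2^{|E₂|}` of configurations of the other side, so `(G⅔)(G) ↔ (G⅔)(G₁)`.

The new ingredient is the dictionary for AVOIDING walks: `walkAvoiding_cut_iff` — for `x, y` on side `s`
(or `v`), a red walk of `G` from `x` to `y` avoiding a vertex set `W` exists iff one exists on side `s`
(an excursion through the other side starts and ends at `v` and is dropped; the proof is the induction of
`conn_cut_iff` with the avoidance carried along), and `walkAvoiding_part_congr` — a walk of a part avoids
`W` iff it avoids `W` restricted to the vertices of that side.  With `conn_cut_iff_same` for the blue
clusters this gives `good_cut_iff`: `Good_t(G, ω) ↔ Good_t(G₁, ω|₁)`.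

* `walkAvoiding_cut_iff`, `walkAvoiding_part_congr`, `mem_cluster_compl_cut_iff`, `good_cut_iff`;
* `card_DA_cut_free`, `card_goodA_cut_free`, `card_goodB_cut_free` — the three counts factor;
* **`goodDegree_iff_of_cut_free`** — `(G⅔)(G) ↔ (G⅔)(G.part side true)`;
* `goodDegree_of_cut_free` — the direction used for reductions.

So ROW C-041 reduces to the block of the marks whenever a mark-free piece hangs at a cut vertex
(g22's HANDOFF item (3); the mathematics is a walk shortcut).
-/

namespace PercRepro

namespace MultiGraph

open Finset

variable {V E : Type*} {G : MultiGraph V E}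

section Walks

variable {v : V} {side : E → Bool}

/-- A vertex carrying an edge of colour `s` is the cut vertex or lies on side `s`. -/
theorem eq_or_onSide_of_hasCol (hg : G.IsGluing v v v side) {s : Bool} {z : V}
    (hz : G.HasCol side s z) : z = v ∨ G.OnSide side s z := by
  by_cases hzv : z = v
  · exact Or.inl hzv
  · right
    intro e' he'
    obtain ⟨e, hes, he⟩ := hz
    exact (hg.col_eq hzv hzv hzv he' he).trans hes

/-- **The avoiding-walk dictionary across a cut vertex**: for `x, y` on side `s` (or equal to `v`), a
walk of `G` from `x` to `y` avoiding `W` exists iff one exists on side `s`. -/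
theorem walkAvoiding_cut_iff (hg : G.IsGluing v v v side) {s t : Bool} (hst : s ≠ t) {x y : V}
    (hx : x = v ∨ G.OnSide side s x) (hy : y = v ∨ G.OnSide side s y) (ω : Config E) (W : Set V) :
    G.WalkAvoiding ω W x y ↔ (G.part side s).WalkAvoiding (sideRestrict ω side s) W x y := by
  constructor
  · rintro ⟨hxW, hwalk⟩
    refine ⟨hxW, ?_⟩
    -- the invariant: on side `s` (or at `v`) we have a side-`s` walk; on side `t` we remember the walk to `v`
    have key : ∀ z, Relation.ReflTransGen (fun p q => G.OpenAdj ω p q ∧ q ∉ W) x z →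
        ((z = v ∨ G.OnSide side s z) ∧ Relation.ReflTransGen
          (fun p q => (G.part side s).OpenAdj (sideRestrict ω side s) p q ∧ q ∉ W) x z) ∨
        (G.HasCol side t z ∧ z ≠ v ∧ Relation.ReflTransGen
          (fun p q => (G.part side s).OpenAdj (sideRestrict ω side s) p q ∧ q ∉ W) x v) := by
      intro z hz
      induction hz with
      | refl => exact Or.inl ⟨hx, Relation.ReflTransGen.refl⟩
      | @tail z z' _ hzz' ih =>
        obtain ⟨⟨e, he, hend⟩, hz'W⟩ := hzz'
        have hj : G.Joins e z z' := hend
        by_cases hse : side e = s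
        · -- an edge of colour `s`: `z` is on side `s` (or `v`), the walk extends
          have hz' : z' = v ∨ G.OnSide side s z' :=
            eq_or_onSide_of_hasCol hg ⟨e, hse, EdgeAt.of_joins_right hj⟩
          rcases ih with ⟨_, hw⟩ | ⟨hcol, hzv, _⟩
          · exact Or.inl ⟨hz', hw.tail ⟨openAdj_part_of_open' hse he hj, hz'W⟩⟩
          · exfalso
            have h2 : G.HasCol side s z := ⟨e, hse, EdgeAt.of_joins_left hj⟩
            exact hst (hg.eq_of_hasCol hzv hzv hzv h2 hcol)
        · -- an edge of colour `t`: we are at `v` or on side `t`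
          have hse' : side e = t := bool_eq_of_ne_of_ne hst hse
          rcases ih with ⟨hzs, hw⟩ | ⟨_, _, hw⟩
          · have hzv : z = v := by
              rcases hzs with hzv | hzs
              · exact hzv
              · exact absurd (hzs e (EdgeAt.of_joins_left hj)) hse
            subst hzv
            by_cases hz'v : z' = z
            · subst hz'v
              exact Or.inl ⟨Or.inl rfl, hw⟩
            · exact Or.inr ⟨⟨e, hse', EdgeAt.of_joins_right hj⟩, hz'v, hw⟩
          · by_cases hz'v : z' = v
            · subst hz'v
              exact Or.inl ⟨Or.inl rfl, hw⟩
            · exact Or.inr ⟨⟨e, hse', EdgeAt.of_joins_right hj⟩, hz'v, hw⟩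
    rcases key y hwalk with ⟨_, hw⟩ | ⟨hcol, hyv, _⟩
    · exact hw
    · exfalso
      rcases hy with hyv' | hys
      · exact hyv hyv'
      · exact not_hasCol_of_onSide hst hys hcol
  · rintro ⟨hxW, hwalk⟩
    exact ⟨hxW, reflTransGen_of_imp (fun _ _ hpq => ⟨OpenAdj.of_part hpq.1, hpq.2⟩) hwalk⟩

/-- A walk of the part of colour `s` only meets vertices of side `s` (or `v`), so it avoids `W` iff it
avoids any `W'` agreeing with `W` on those vertices. -/
theorem walkAvoiding_part_congr (hg : G.IsGluing v v v side) {s : Bool} {x y : V}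
    (hx : x = v ∨ G.OnSide side s x) (ω₁ : Config {e // side e = s}) {W W' : Set V}
    (hWW' : ∀ z, z = v ∨ G.OnSide side s z → (z ∈ W ↔ z ∈ W')) :
    (G.part side s).WalkAvoiding ω₁ W x y ↔ (G.part side s).WalkAvoiding ω₁ W' x y := by
  have step : ∀ p q, (G.part side s).OpenAdj ω₁ p q → (q = v ∨ G.OnSide side s q) := by
    intro p q hpq
    obtain ⟨e, _, hend⟩ := hpq
    refine eq_or_onSide_of_hasCol hg ⟨e.1, e.2, ?_⟩
    rcases hend with ⟨_, h2⟩ | ⟨h1, _⟩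
    · exact Or.inr h2
    · exact Or.inl h1
  constructor
  · rintro ⟨hxW, hw⟩
    refine ⟨(hWW' x hx).not.1 hxW, ?_⟩
    exact reflTransGen_of_imp (fun p q hpq => ⟨hpq.1, (hWW' q (step p q hpq.1)).not.1 hpq.2⟩) hw
  · rintro ⟨hxW, hw⟩
    refine ⟨(hWW' x hx).not.2 hxW, ?_⟩
    exact reflTransGen_of_imp (fun p q hpq => ⟨hpq.1, (hWW' q (step p q hpq.1)).not.2 hpq.2⟩) hw

/-- The blue cluster of a vertex `u` on side `s` (or `v`), seen from the vertices of that side, is its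
blue cluster in the part. -/
theorem mem_cluster_compl_cut_iff (hg : G.IsGluing v v v side) {s t : Bool} (hst : s ≠ t) {u z : V}
    (hu : u = v ∨ G.OnSide side s u) (hz : z = v ∨ G.OnSide side s z) (ω : Config E) :
    z ∈ G.cluster ωᶜ u ↔ z ∈ (G.part side s).cluster (sideRestrict ω side s)ᶜ u := by
  rw [mem_cluster, mem_cluster, conn_cut_iff_same hg hst hu hz ωᶜ, sideRestrict_compl]

/-- **`Good_t` transfers across a mark-free side**: for `u, x, y` on side `s` (or `v`), «`y` is reached
from `x` by a red walk avoiding the blue cluster of `u`» holds in `G` iff it holds on side `s`. -/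
theorem good_cut_iff (hg : G.IsGluing v v v side) {s t : Bool} (hst : s ≠ t) {u x y : V}
    (hu : u = v ∨ G.OnSide side s u) (hx : x = v ∨ G.OnSide side s x)
    (hy : y = v ∨ G.OnSide side s y) (ω : Config E) :
    G.WalkAvoiding ω (G.cluster ωᶜ u) x y ↔
      (G.part side s).WalkAvoiding (sideRestrict ω side s)
        ((G.part side s).cluster (sideRestrict ω side s)ᶜ u) x y := by
  rw [walkAvoiding_cut_iff hg hst hx hy]
  exact walkAvoiding_part_congr hg hx _ fun z hz => mem_cluster_compl_cut_iff hg hst hu hz ω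

end Walks

section Count

variable [Fintype E] {v : V} {side : E → Bool}

omit [Fintype E] in
/-- The `(D,A)` predicate transfers across a mark-free side. -/
theorem DA_cut_iff (hg : G.IsGluing v v v side) {a b c : V}
    (ha : a = v ∨ G.OnSide side true a) (hb : b = v ∨ G.OnSide side true b)
    (hc : c = v ∨ G.OnSide side true c) (ω : Config E) :
    ((G.Conn ω c a ∧ G.Conn ω c b) ∧ (¬ G.Conn ωᶜ c a ∧ ¬ G.Conn ωᶜ c b ∧ ¬ G.Conn ωᶜ a b)) ↔
      (((G.part side true).Conn (sideRestrict ω side true) c a ∧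
          (G.part side true).Conn (sideRestrict ω side true) c b) ∧
        (¬ (G.part side true).Conn (sideRestrict ω side true)ᶜ c a ∧
          ¬ (G.part side true).Conn (sideRestrict ω side true)ᶜ c b ∧
          ¬ (G.part side true).Conn (sideRestrict ω side true)ᶜ a b)) := by
  have htf : true ≠ false := by decide
  rw [conn_cut_iff_same hg htf hc ha ω, conn_cut_iff_same hg htf hc hb ω,
    conn_cut_iff_same hg htf hc ha ωᶜ, conn_cut_iff_same hg htf hc hb ωᶜ,
    conn_cut_iff_same hg htf ha hb ωᶜ, sideRestrict_compl]

open Classical in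
/-- `n(D,A)` factors across a mark-free side. -/
theorem card_DA_cut_free (hg : G.IsGluing v v v side) {a b c : V}
    (ha : a = v ∨ G.OnSide side true a) (hb : b = v ∨ G.OnSide side true b)
    (hc : c = v ∨ G.OnSide side true c) :
    (univ.filter fun ω : Config E => (G.Conn ω c a ∧ G.Conn ω c b) ∧
        (¬ G.Conn ωᶜ c a ∧ ¬ G.Conn ωᶜ c b ∧ ¬ G.Conn ωᶜ a b)).card =
      (univ.filter fun ω₁ : Config {e // side e = true} =>
        ((G.part side true).Conn ω₁ c a ∧ (G.part side true).Conn ω₁ c b) ∧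
        (¬ (G.part side true).Conn ω₁ᶜ c a ∧ ¬ (G.part side true).Conn ω₁ᶜ c b ∧
          ¬ (G.part side true).Conn ω₁ᶜ a b)).card *
        (univ : Finset (Config {e // side e = false})).card := by
  have hfilt : (univ.filter fun ω : Config E => (G.Conn ω c a ∧ G.Conn ω c b) ∧
      (¬ G.Conn ωᶜ c a ∧ ¬ G.Conn ωᶜ c b ∧ ¬ G.Conn ωᶜ a b)) =
      univ.filter fun ω : Config E =>
        (((G.part side true).Conn (sideRestrict ω side true) c a ∧
          (G.part side true).Conn (sideRestrict ω side true) c b) ∧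
        (¬ (G.part side true).Conn (sideRestrict ω side true)ᶜ c a ∧
          ¬ (G.part side true).Conn (sideRestrict ω side true)ᶜ c b ∧
          ¬ (G.part side true).Conn (sideRestrict ω side true)ᶜ a b)) :=
    filter_congr fun ω _ => DA_cut_iff hg ha hb hc ω
  rw [hfilt]
  convert card_filter_true_side (fun ω₁ : Config {e // side e = true} =>
    ((G.part side true).Conn ω₁ c a ∧ (G.part side true).Conn ω₁ c b) ∧
    (¬ (G.part side true).Conn ω₁ᶜ c a ∧ ¬ (G.part side true).Conn ω₁ᶜ c b ∧
      ¬ (G.part side true).Conn ω₁ᶜ a b)) using 5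

open Classical in
/-- `#Good_a` factors across a mark-free side. -/
theorem card_goodA_cut_free (hg : G.IsGluing v v v side) {a b c : V}
    (ha : a = v ∨ G.OnSide side true a) (hb : b = v ∨ G.OnSide side true b)
    (hc : c = v ∨ G.OnSide side true c) :
    (univ.filter fun ω : Config E => ((G.Conn ω c a ∧ G.Conn ω c b) ∧
        (¬ G.Conn ωᶜ c a ∧ ¬ G.Conn ωᶜ c b ∧ ¬ G.Conn ωᶜ a b)) ∧
        G.WalkAvoiding ω (G.cluster ωᶜ a) c b).card =
      (univ.filter fun ω₁ : Config {e // side e = true} =>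
        (((G.part side true).Conn ω₁ c a ∧ (G.part side true).Conn ω₁ c b) ∧
        (¬ (G.part side true).Conn ω₁ᶜ c a ∧ ¬ (G.part side true).Conn ω₁ᶜ c b ∧
          ¬ (G.part side true).Conn ω₁ᶜ a b)) ∧
        (G.part side true).WalkAvoiding ω₁ ((G.part side true).cluster ω₁ᶜ a) c b).card *
        (univ : Finset (Config {e // side e = false})).card := by
  have htf : true ≠ false := by decide
  have hfilt : (univ.filter fun ω : Config E => ((G.Conn ω c a ∧ G.Conn ω c b) ∧
      (¬ G.Conn ωᶜ c a ∧ ¬ G.Conn ωᶜ c b ∧ ¬ G.Conn ωᶜ a b)) ∧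
      G.WalkAvoiding ω (G.cluster ωᶜ a) c b) =
      univ.filter fun ω : Config E =>
        ((((G.part side true).Conn (sideRestrict ω side true) c a ∧
          (G.part side true).Conn (sideRestrict ω side true) c b) ∧
        (¬ (G.part side true).Conn (sideRestrict ω side true)ᶜ c a ∧
          ¬ (G.part side true).Conn (sideRestrict ω side true)ᶜ c b ∧
          ¬ (G.part side true).Conn (sideRestrict ω side true)ᶜ a b)) ∧
        (G.part side true).WalkAvoiding (sideRestrict ω side true)
          ((G.part side true).cluster (sideRestrict ω side true)ᶜ a) c b) :=
    filter_congr fun ω _ => by rw [DA_cut_iff hg ha hb hc ω, good_cut_iff hg htf ha hc hb ω]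
  rw [hfilt]
  convert card_filter_true_side (fun ω₁ : Config {e // side e = true} =>
    (((G.part side true).Conn ω₁ c a ∧ (G.part side true).Conn ω₁ c b) ∧
    (¬ (G.part side true).Conn ω₁ᶜ c a ∧ ¬ (G.part side true).Conn ω₁ᶜ c b ∧
      ¬ (G.part side true).Conn ω₁ᶜ a b)) ∧
    (G.part side true).WalkAvoiding ω₁ ((G.part side true).cluster ω₁ᶜ a) c b) using 5

open Classical in
/-- `#Good_b` factors across a mark-free side. -/
theorem card_goodB_cut_free (hg : G.IsGluing v v v side) {a b c : V}
    (ha : a = v ∨ G.OnSide side true a) (hb : b = v ∨ G.OnSide side true b)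
    (hc : c = v ∨ G.OnSide side true c) :
    (univ.filter fun ω : Config E => ((G.Conn ω c a ∧ G.Conn ω c b) ∧
        (¬ G.Conn ωᶜ c a ∧ ¬ G.Conn ωᶜ c b ∧ ¬ G.Conn ωᶜ a b)) ∧
        G.WalkAvoiding ω (G.cluster ωᶜ b) c a).card =
      (univ.filter fun ω₁ : Config {e // side e = true} =>
        (((G.part side true).Conn ω₁ c a ∧ (G.part side true).Conn ω₁ c b) ∧
        (¬ (G.part side true).Conn ω₁ᶜ c a ∧ ¬ (G.part side true).Conn ω₁ᶜ c b ∧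
          ¬ (G.part side true).Conn ω₁ᶜ a b)) ∧
        (G.part side true).WalkAvoiding ω₁ ((G.part side true).cluster ω₁ᶜ b) c a).card *
        (univ : Finset (Config {e // side e = false})).card := by
  have htf : true ≠ false := by decide
  have hfilt : (univ.filter fun ω : Config E => ((G.Conn ω c a ∧ G.Conn ω c b) ∧
      (¬ G.Conn ωᶜ c a ∧ ¬ G.Conn ωᶜ c b ∧ ¬ G.Conn ωᶜ a b)) ∧
      G.WalkAvoiding ω (G.cluster ωᶜ b) c a) =
      univ.filter fun ω : Config E =>
        ((((G.part side true).Conn (sideRestrict ω side true) c a ∧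
          (G.part side true).Conn (sideRestrict ω side true) c b) ∧
        (¬ (G.part side true).Conn (sideRestrict ω side true)ᶜ c a ∧
          ¬ (G.part side true).Conn (sideRestrict ω side true)ᶜ c b ∧
          ¬ (G.part side true).Conn (sideRestrict ω side true)ᶜ a b)) ∧
        (G.part side true).WalkAvoiding (sideRestrict ω side true)
          ((G.part side true).cluster (sideRestrict ω side true)ᶜ b) c a) :=
    filter_congr fun ω _ => by rw [DA_cut_iff hg ha hb hc ω, good_cut_iff hg htf hb hc ha ω]
  rw [hfilt]
  convert card_filter_true_side (fun ω₁ : Config {e // side e = true} =>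
    (((G.part side true).Conn ω₁ c a ∧ (G.part side true).Conn ω₁ c b) ∧
    (¬ (G.part side true).Conn ω₁ᶜ c a ∧ ¬ (G.part side true).Conn ω₁ᶜ c b ∧
      ¬ (G.part side true).Conn ω₁ᶜ a b)) ∧
    (G.part side true).WalkAvoiding ω₁ ((G.part side true).cluster ω₁ᶜ b) c a) using 5

omit [Fintype E] in
/-- The arithmetic of a common positive factor: `2·(N·K) ≤ 3·(A·K + B·K) ↔ 2·N ≤ 3·(A + B)` for `K > 0`. -/
theorem two_mul_le_iff_of_pos {N A B K : ℕ} (hK : 0 < K) :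
    2 * (N * K) ≤ 3 * (A * K + B * K) ↔ 2 * N ≤ 3 * (A + B) := by
  constructor
  · intro h
    have h' : (2 * N) * K ≤ (3 * (A + B)) * K := by
      calc (2 * N) * K = 2 * (N * K) := by ring
        _ ≤ 3 * (A * K + B * K) := h
        _ = (3 * (A + B)) * K := by ring
    exact Nat.le_of_mul_le_mul_right h' hK
  · intro h
    calc 2 * (N * K) = (2 * N) * K := by ring
      _ ≤ (3 * (A + B)) * K := Nat.mul_le_mul_right K h
      _ = 3 * (A * K + B * K) := by ring

open Classical in
/-- **ROW C-041 `(G⅔)` is invariant under a mark-free side**: with the probe and both terminals on side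
`true` (or equal to the cut vertex), `(G⅔)` holds on `G` iff it holds on `G.part side true`. -/
theorem goodDegree_iff_of_cut_free (hg : G.IsGluing v v v side) {a b c : V}
    (ha : a = v ∨ G.OnSide side true a) (hb : b = v ∨ G.OnSide side true b)
    (hc : c = v ∨ G.OnSide side true c) :
    (2 * (univ.filter fun S : Config E => (G.Conn S c a ∧ G.Conn S c b) ∧
          (¬ G.Conn Sᶜ c a ∧ ¬ G.Conn Sᶜ c b ∧ ¬ G.Conn Sᶜ a b)).card ≤
        3 * ((univ.filter fun S : Config E => ((G.Conn S c a ∧ G.Conn S c b) ∧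
            (¬ G.Conn Sᶜ c a ∧ ¬ G.Conn Sᶜ c b ∧ ¬ G.Conn Sᶜ a b)) ∧
            G.WalkAvoiding S (G.cluster Sᶜ a) c b).card +
          (univ.filter fun S : Config E => ((G.Conn S c a ∧ G.Conn S c b) ∧
            (¬ G.Conn Sᶜ c a ∧ ¬ G.Conn Sᶜ c b ∧ ¬ G.Conn Sᶜ a b)) ∧
            G.WalkAvoiding S (G.cluster Sᶜ b) c a).card)) ↔
      (2 * (univ.filter fun S : Config {e // side e = true} =>
            ((G.part side true).Conn S c a ∧ (G.part side true).Conn S c b) ∧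
            (¬ (G.part side true).Conn Sᶜ c a ∧ ¬ (G.part side true).Conn Sᶜ c b ∧
              ¬ (G.part side true).Conn Sᶜ a b)).card ≤
        3 * ((univ.filter fun S : Config {e // side e = true} =>
            (((G.part side true).Conn S c a ∧ (G.part side true).Conn S c b) ∧
            (¬ (G.part side true).Conn Sᶜ c a ∧ ¬ (G.part side true).Conn Sᶜ c b ∧
              ¬ (G.part side true).Conn Sᶜ a b)) ∧
            (G.part side true).WalkAvoiding S ((G.part side true).cluster Sᶜ a) c b).card +
          (univ.filter fun S : Config {e // side e = true} =>
            (((G.part side true).Conn S c a ∧ (G.part side true).Conn S c b) ∧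
            (¬ (G.part side true).Conn Sᶜ c a ∧ ¬ (G.part side true).Conn Sᶜ c b ∧
              ¬ (G.part side true).Conn Sᶜ a b)) ∧
            (G.part side true).WalkAvoiding S ((G.part side true).cluster Sᶜ b) c a).card)) := by
  rw [card_DA_cut_free hg ha hb hc, card_goodA_cut_free hg ha hb hc, card_goodB_cut_free hg ha hb hc]
  exact two_mul_le_iff_of_pos (card_pos.2 ⟨⊥, mem_univ _⟩)

open Classical in
/-- **ROW C-041 `(G⅔)` from the block of the marks**: if `(G⅔)` holds on the side `true` of a cut vertex
carrying the probe and both terminals, it holds on `G`. -/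
theorem goodDegree_of_cut_free (hg : G.IsGluing v v v side) {a b c : V}
    (ha : a = v ∨ G.OnSide side true a) (hb : b = v ∨ G.OnSide side true b)
    (hc : c = v ∨ G.OnSide side true c)
    (h : 2 * (univ.filter fun S : Config {e // side e = true} =>
            ((G.part side true).Conn S c a ∧ (G.part side true).Conn S c b) ∧
            (¬ (G.part side true).Conn Sᶜ c a ∧ ¬ (G.part side true).Conn Sᶜ c b ∧
              ¬ (G.part side true).Conn Sᶜ a b)).card ≤
        3 * ((univ.filter fun S : Config {e // side e = true} =>
            (((G.part side true).Conn S c a ∧ (G.part side true).Conn S c b) ∧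
            (¬ (G.part side true).Conn Sᶜ c a ∧ ¬ (G.part side true).Conn Sᶜ c b ∧
              ¬ (G.part side true).Conn Sᶜ a b)) ∧
            (G.part side true).WalkAvoiding S ((G.part side true).cluster Sᶜ a) c b).card +
          (univ.filter fun S : Config {e // side e = true} =>
            (((G.part side true).Conn S c a ∧ (G.part side true).Conn S c b) ∧
            (¬ (G.part side true).Conn Sᶜ c a ∧ ¬ (G.part side true).Conn Sᶜ c b ∧
              ¬ (G.part side true).Conn Sᶜ a b)) ∧
            (G.part side true).WalkAvoiding S ((G.part side true).cluster Sᶜ b) c a).card)) :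
    2 * (univ.filter fun S : Config E => (G.Conn S c a ∧ G.Conn S c b) ∧
          (¬ G.Conn Sᶜ c a ∧ ¬ G.Conn Sᶜ c b ∧ ¬ G.Conn Sᶜ a b)).card ≤
        3 * ((univ.filter fun S : Config E => ((G.Conn S c a ∧ G.Conn S c b) ∧
            (¬ G.Conn Sᶜ c a ∧ ¬ G.Conn Sᶜ c b ∧ ¬ G.Conn Sᶜ a b)) ∧
            G.WalkAvoiding S (G.cluster Sᶜ a) c b).card +
          (univ.filter fun S : Config E => ((G.Conn S c a ∧ G.Conn S c b) ∧
            (¬ G.Conn Sᶜ c a ∧ ¬ G.Conn Sᶜ c b ∧ ¬ G.Conn Sᶜ a b)) ∧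
            G.WalkAvoiding S (G.cluster Sᶜ b) c a).card) :=
  (goodDegree_iff_of_cut_free hg ha hb hc).2 h

end Count

end MultiGraph

end PercRepro
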